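import Summits.ResolutionOfSingularities.ResolutionOfSingularities.Theorems.FrobeniusLadderFInjectiveMacaulayficationLx6q7PointKChar2FanChecks

/-!
# lx6q7-mK / 2 ROAD-B DATA (d4lx6q7 POINT FLOOR, CURE HALF): the fan, the strict transforms and the Fedder cells of the monomial blow-up certificate of
# `z² + x⁶z + y³ + u³ + t⁷ ⊂ 𝔸⁵` in characteristic `2` along the PRODUCT centre `𝔪·K`, `𝔪 = (x, y, u, t, z)`, `K` = 156 monomials (`𝔪`-primary)
# (crux `FInjectiveMacaulayfication` stmt-ResolutionOfSingularities-15315, chain w45a; input side = res-L1-w45a-stub-3 g10's ✓ p639147 `Lx6q7PointFloor.pointFloor_lx6q7_input_legal` / `pointFloor_lx6q7_not_full`; seat res-L1-w45a-stub-2 g9, own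
# certificate `cert/Lx6q7-mK-product-toric-cert.json` sha256/16 `c4dd909ca828f12c` + factor `Lx6q7-mK-factor.json` sha256/16 `b468cef147e70da9` (generators `cert/search.py` (fan search) + `cert/build_cert.py`,
# mirrored in `L/res-L1-w45a-stub-2/p2d5c/`); file GENERATED by `gen_fan_cert.py` (dialect: thin cells, multi-vertex cover records))

Support file for crux stmt-ResolutionOfSingularities-15315 (`FrobeniusLadder.FInjectiveMacaulayfication`), chain w45a.
[OURS · L1 W4.5a] — NOT a statement of any manuscript; AI-written (script-generated from the certificate above), weaker than expert review.

WHY. the K-TT-a bed d4lx6q7 — the admissible point floor from which the rad-τ recipe of record is PERIODIC (RULING R19.16: `TauTowerConjecture` refuted by evidence) — so this certificate puts the F-half's ∃-conclusion IN THE KERNEL at the very germ where the memoryless Frobenius-data recipes die (today: evidence-level «coordinate cures exist on every clock germ»).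
WHAT. The hypersurface `f = z² + x⁶z + y³ + u³ + t⁷` (variables `(x, y, u, t, z) = (X 0, …, X 4)`, `char k = 2`; specimen package `Lx6q7Specimen`) blown up along the `𝔪`-primary MONOMIAL ideal
`I_A = 𝔪·K` (`|A| = 520`; pure powers of all variables in `A`, `hprim_raw`), `41` unimodular charts = the fan obtained from the positive orthant of `ℤ⁵` by the
9 smooth star subdivisions (each at the sum of the rays of a face lying over the origin)
`(1,1,1,1,1) → (1,1,1,1,2) → (1,2,2,1,3) → (1,3,3,2,4) → (1,3,3,2,5) → (1,4,4,2,6) → (2,7,7,3,10) → (2,7,7,3,11) → (3,12,12,5,18)`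
(found by a beam search over such subdivisions with the target «every strict transform has a split class `c_r = 1`»); `K` = the lattice polytope of a strictly concave support
function on that fan (an integer combination of the exceptional support functions, margins ≥ 1, then vertices + chart neighbours + pure powers); on EVERY chart the strict transform
`g_c` has a parity class `r ∈ {0,1}ⁿ` whose only term is `Y^r` (thin Fedder cell `1 = 1 · expand 2 (c_r)`), so `g_c ∉ P^[2]` at every prime: every chart is F-pure at EVERY point.
Consumer: `…Lx6q7PointKBlowupFull` (`affineBlowup (floor * K)` FULL at every point, `span_A_eq_floor_mul_K`) → `Lx6q7PointFloorRow.pointFloor_lx6q7_row` via res-L1-w45a-stub-3's generic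
`FHalfRowOfProductCentre.fHalfConclusion_of_affineBlowup_mul` (p618085 §2). Tables `AL`/`A`, `V`/`Vinv`, `mv`/`m`, `av`/`a`, `dv`/`d`, `FL`, `G`, `RLM`, `Nu`/`rv`,
`CELLS`, `TL`/`TA`, `KL`/`KA`; binder theorems for `RoadBFrame.hon_of_kernelChecks` / `CICertificates.ciCertificates` at `p = 2`, `n = 5`, `t = 41`, each ONE kernel `decide`.
Definitions are plain data tables (no instances, no notation); no named facts. [folklore; cite: CoxLittleSchenck2011, §2.3; Fedder1983, Thm. 1.12]
-/

-- single-problem summit: the doubled namespace component is forced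
set_option linter.dupNamespace false

noncomputable section

namespace Summit.ResolutionOfSingularities.ResolutionOfSingularities.Theorems.FInjectiveMacaulayfication.Lx6q7PointKChar2Fan

open MvPolynomial
open Summit.ResolutionOfSingularities.ResolutionOfSingularities.Theorems.FInjectiveMacaulayfication

/-! ## Raw kernel checks, product and polynomial side (one `decide` each); the binders of `RoadBFrame.hon_of_kernelChecks` / `CICertificates.ciCertificates` — tables in `Lx6q7PointKChar2FanTables`, chart-side checks in `Lx6q7PointKChar2FanChecks` -/

/-- `0 ∉ AL`, every generator involves some variable, and the table length (the length conjunct keeps this specimen's statement distinct from its sibling fan modules). -/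
theorem hA0AJ_raw : (0 : Fin 5 → ℕ) ∉ AL ∧ (∀ v ∈ AL, ∃ j : Fin 5, 0 < v j) ∧ AL.length = 520 := by decide +kernel

/-- ★ THE PRODUCT TABLES, WITNESSED (one `decide`): (i) along `AL`, the indexed product `x^τ · x^b` divides `x^v`; (ii) along `TL ×ˢ KL`, the indexed generator of `A`
divides `x^τ · x^b`; (iii) `TL` is literally the floor's exponent list; (iv) `|KL|` (keeps the statement specimen-distinct). -/
theorem hprod_w : List.Forall₂ (fun (v : Fin 5 → ℕ) (w : ℕ × ℕ) => w.1 < TL.length ∧ w.2 < KL.length ∧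
      ∀ i : Fin 5, FanCheckKit.getL TL w.1 0 i + FanCheckKit.getL KL w.2 0 i ≤ v i) AL WAK ∧
    List.Forall₂ (fun (q : (Fin 5 → ℕ) × (Fin 5 → ℕ)) (w : ℕ) => w < AL.length ∧
      ∀ i : Fin 5, FanCheckKit.getL AL w 0 i ≤ q.1 i + q.2 i) (TL ×ˢ KL) WKA ∧
    TL = [Pi.single 0 1, Pi.single 1 1, Pi.single 2 1, Pi.single 3 1, Pi.single 4 1] ∧ KL.length = 156 := by
  decide +kernel

/-- ★ **`span (x^A) = floor · K` on exponents**: (A ⊆ floor·K) every generator of `A` is divisible by a product `x^τ · x^b`; (floor·K ⊆ A) every product is divisible by a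
generator of `A`; `TL` verbatim; `|KL|`. Derived from the witnessed tables `hprod_w`. -/
theorem hprodTables : (∀ v ∈ AL, ∃ τ ∈ TL, ∃ b ∈ KL, ∀ i : Fin 5, τ i + b i ≤ v i) ∧
    (∀ τ ∈ TL, ∀ b ∈ KL, ∃ v ∈ AL, ∀ i : Fin 5, v i ≤ τ i + b i) ∧
    TL = [Pi.single 0 1, Pi.single 1 1, Pi.single 2 1, Pi.single 3 1, Pi.single 4 1] ∧ KL.length = 156 := by
  obtain ⟨hAK, hKA, hTL, hlen⟩ := hprod_w
  refine ⟨fun v hv => ?_, fun τ hτ b hb => ?_, hTL, hlen⟩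
  · obtain ⟨w, -, h1, h2, hle⟩ := P2d4CChar2Fan.exists_of_forall₂ hAK v hv
    exact ⟨_, FanCheckSound.getL_mem _ _ _ h1, _, FanCheckSound.getL_mem _ _ _ h2, hle⟩
  · obtain ⟨w, -, hw, hle⟩ := P2d4CChar2Fan.exists_of_forall₂ hKA (τ, b) (List.pair_mem_product.mpr ⟨hτ, hb⟩)
    exact ⟨_, FanCheckSound.getL_mem _ _ _ hw, hle⟩

/-- The pure powers of all variables in `K` (`K` is `𝔪`-primary). -/
theorem hKprim_raw : (Pi.single 0 168 : Fin 5 → ℕ) ∈ KL ∧ (Pi.single 1 98 : Fin 5 → ℕ) ∈ KL ∧ (Pi.single 2 98 : Fin 5 → ℕ) ∈ KL ∧ (Pi.single 3 145 : Fin 5 → ℕ) ∈ KL ∧ (Pi.single 4 50 : Fin 5 → ℕ) ∈ KL := by decide +kernel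

/-- The pure powers of `A`. -/
theorem hprim_raw : (Pi.single 0 169 : Fin 5 → ℕ) ∈ AL ∧ (Pi.single 1 99 : Fin 5 → ℕ) ∈ AL ∧ (Pi.single 2 99 : Fin 5 → ℕ) ∈ AL ∧ (Pi.single 3 146 : Fin 5 → ℕ) ∈ AL ∧ (Pi.single 4 51 : Fin 5 → ℕ) ∈ AL := by decide +kernel

/-- The `θ`-factorisation witnesses: termwise `V_c · e = d_c + e'`, equal coefficients. -/
theorem hθ_raw : ∀ c : Fin 41, List.Forall₂ (fun t t' : ℤ × (Fin 5 → ℕ) => t.1 = t'.1 ∧ (V c).mulVec t.2 = dv c + t'.2) FL (G c) := by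
  decide +kernel

/-- For every chart and variable, a term of `g_c` free of that variable whose coefficient class is odd. -/
theorem hX_raw : ∀ (c : Fin 41) (i : Fin 5), ∃ t ∈ G c, t.2 i = 0 ∧
    ¬ ((2 : ℤ) ∣ (((G c).filter fun s : ℤ × (Fin 5 → ℕ) => s.2 = t.2).map fun s : ℤ × (Fin 5 → ℕ) => s.1).sum) := by
  decide +kernel

/-- ★ THE FEDDER CERTIFICATES: every chart passes the kernel cell check at `p = 2`. -/
theorem hcheck : ∀ c : Fin 41, KLocCellKit.checkKs 2 (G c) (CELLS c) = true := by decide +kernel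

/-- Every chart carries the cell `S = ∅`. -/
theorem hS_raw : ∀ c : Fin 41, (∅ : Finset (Fin 5)) ∈ (CELLS c).map Prod.fst := by decide +kernel

/-- The (thin) cells cover every zero pattern over the origin (`∅ ⊆ T`). -/
theorem hSS : ∀ (c : Fin 41) (T : Finset (Fin 5)), (∀ j ∈ (Finset.univ : Finset (Fin 5)), ∃ i ∈ T, 0 < V c i j) →
    ∃ S ∈ (CELLS c).map Prod.fst, S ⊆ T :=
  fun c T _ => ⟨∅, hS_raw c, Finset.empty_subset T⟩

/-- ★ THE CENTRE BINDERS (frame shape, `J = univ`): every generator involves a variable, and pure powers of all variables lie in `A` (the centre is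
`𝔪`-primary); `|AL|` keeps the statement specimen-distinct. Use `hprimAJ.1` for `hAJ` and `hprimAJ.2.1` for `hprim`. -/
theorem hprimAJ : (∀ e ∈ A, ∃ j ∈ (Finset.univ : Finset (Fin 5)), 0 < e j) ∧
    (∀ j ∈ (Finset.univ : Finset (Fin 5)), ∃ N : ℕ, Finsupp.single j N ∈ A) ∧ AL.length = 520 := by
  obtain ⟨-, hAJ, hlen⟩ := hA0AJ_raw
  obtain ⟨h0, h1, h2, h3, h4⟩ := hprim_raw
  refine ⟨fun e he => ?_, fun j _ => ?_, hlen⟩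
  · obtain ⟨v, hv, rfl⟩ := Q6CNKit.exists_of_mem_image_symm AL e he
    obtain ⟨j, hj⟩ := hAJ v hv
    exact ⟨j, Finset.mem_univ j, by rw [Finsupp.coe_equivFunOnFinite_symm]; exact hj⟩
  · fin_cases j
    · exact ⟨169, Q6CNKit.single_mem AL 0 169 h0⟩
    · exact ⟨99, Q6CNKit.single_mem AL 1 99 h1⟩
    · exact ⟨99, Q6CNKit.single_mem AL 2 99 h2⟩
    · exact ⟨146, Q6CNKit.single_mem AL 3 146 h3⟩
    · exact ⟨51, Q6CNKit.single_mem AL 4 51 h4⟩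

/-- The vertices are generators. -/
theorem hm : ∀ c : Fin 41, m c ∈ A := fun c => (Q6CNKit.mem_image_symm AL (mv c)).mpr (hm_raw c)

/-- The neighbours are generators. -/
theorem haA : ∀ (c : Fin 41) (i : Fin 5), a c i ∈ A := fun c i => (Q6CNKit.mem_image_symm AL (av c i)).mpr (haA_raw c i)

/-- The chart matrices are unimodular. -/
theorem hV : ∀ c : Fin 41, IsUnit (((V c).map (Nat.cast : ℕ → ℤ)).det) := fun c => Matrix.isUnit_det_of_left_inverse (hV_raw c)

/-- (hgen) `V_c a_c i = V_c m_c + e_i`. -/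
theorem hgen : ∀ (c : Fin 41) (i : Fin 5), (Finsupp.equivFunOnFinite.symm ((V c).mulVec ⇑(a c i)) : Fin 5 →₀ ℕ) =
    Finsupp.equivFunOnFinite.symm ((V c).mulVec ⇑(m c)) + Finsupp.single i 1 :=
  fun c i => Q6CNKit.hgen_of_vec (V c) (av c i) (mv c) i (hgen_raw c i)

/-- (h≥) `m_c` minimises every row of `V_c` over `A`. -/
theorem hge : ∀ (c : Fin 41), ∀ e ∈ A, (Finsupp.equivFunOnFinite.symm ((V c).mulVec ⇑(m c)) : Fin 5 →₀ ℕ) ≤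
    Finsupp.equivFunOnFinite.symm ((V c).mulVec ⇑e) :=
  fun c => Q6CNKit.hge_of_vec (V c) AL (mv c) (hge_raw c)

/-- Pushing `symm` through a sum of scaled raw vectors over the 41 charts. [folklore] -/
theorem symm_sum_smul_charts_41 (cnt : Fin 41 → ℕ) (b : Fin 41 → Fin 5 → ℕ) :
    (Finsupp.equivFunOnFinite.symm (∑ c : Fin 41, cnt c • b c) : Fin 5 →₀ ℕ) = ∑ c : Fin 41, cnt c • (Finsupp.equivFunOnFinite.symm (b c) : Fin 5 →₀ ℕ) := by
  ext i
  simp only [Finsupp.coe_finsetSum, Finsupp.coe_smul, Finset.sum_apply, Pi.smul_apply, Finsupp.coe_equivFunOnFinite_symm,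
    smul_eq_mul]

/-- `hcov`: the cover identities `(Y^e)^K = Y^(m c) · y`, `y ∈ I_A^(K-1)`, from the MULTI-VERTEX records (res-L1-w45a-lead-1's `MonomialCoverMultiRecord.hcov_of_multiRecord`). -/
theorem hcov (k : Type) [Field k] : ∀ e ∈ A, ∃ (c : Fin 41) (K : ℕ), 1 ≤ K ∧
    ∃ y ∈ (Ideal.span ((fun b : Fin 5 →₀ ℕ => (MvPolynomial.monomial b (1 : k) : MvPolynomial (Fin 5) k)) '' (A : Set (Fin 5 →₀ ℕ)))) ^ (K - 1),
      (MvPolynomial.monomial e (1 : k) : MvPolynomial (Fin 5) k) ^ K = MvPolynomial.monomial (m c) 1 * y := by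
  intro e he
  obtain ⟨v, hv, rfl⟩ := Q6CNKit.exists_of_mem_image_symm AL e he
  obtain ⟨rec, -, hc₀, hid⟩ := P2d4CChar2Fan.exists_of_forall₂ hcovM_raw v hv
  refine MonomialCoverMultiRecord.hcov_of_multiRecord k A m hm _ rec.1 rec.2.1 hc₀ (Finsupp.equivFunOnFinite.symm rec.2.2) ?_
  show (∑ c : Fin 41, rec.2.1 c) • (Finsupp.equivFunOnFinite.symm v : Fin 5 →₀ ℕ) =
    ∑ c : Fin 41, rec.2.1 c • Finsupp.equivFunOnFinite.symm (mv c) + Finsupp.equivFunOnFinite.symm rec.2.2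
  rw [← Q6CNKit.symm_nsmul, hid, Q6CNKit.symm_add, symm_sum_smul_charts_41]

/-- `f` is the value of the term list `FL`. [folklore] -/
theorem f_eq_evalL (k : Type) [Field k] :
    (X 4 ^ 2 + X 0 ^ 6 * X 4 + X 1 ^ 3 + X 2 ^ 3 + X 3 ^ 7 : MvPolynomial (Fin 5) k) = KLocCellKit.evalL k FL := by
  simp only [KLocCellKit.evalL, FL, List.map_cons, List.map_nil, List.sum_cons, List.sum_nil, Int.cast_one,
    PConeFedderData.monomial_five]
  ring

/-- `hθF`: `θ_(V c) f = Y^(d c) · g_c` with `g_c = KLocCellKit.evalL k (G c)` (binder shape of `originPointFixable_of_kernelChecks`). -/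
theorem hθF₀ (k : Type) [Field k] : ∀ c : Fin 41,
    aeval (fun j : Fin 5 => ∏ i : Fin 5, (X i : MvPolynomial (Fin 5) k) ^ V c i j) (X 4 ^ 2 + X 0 ^ 6 * X 4 + X 1 ^ 3 + X 2 ^ 3 + X 3 ^ 7 : MvPolynomial (Fin 5) k) =
      monomial (d c 0) (1 : k) * KLocCellKit.evalL k (G c) := by
  intro c
  rw [f_eq_evalL]
  exact CIPolyKit.theta_evalL (V c) (dv c) FL (G c) (hθ_raw c)

/-- `hunit`: `N • m_c = Σ_j d_c j • a_c j + r'`. -/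
theorem hunit : ∀ (c : Fin 41) (l : Fin 1), ∃ (N : ℕ) (r' : Fin 5 →₀ ℕ), N • m c = ∑ j : Fin 5, d c l j • a c j + r' := by
  intro c l
  refine ⟨Nu c, Finsupp.equivFunOnFinite.symm (rv c), ?_⟩
  show Nu c • (Finsupp.equivFunOnFinite.symm (mv c) : Fin 5 →₀ ℕ) =
    ∑ j : Fin 5, (Finsupp.equivFunOnFinite.symm (dv c) : Fin 5 →₀ ℕ) j • (Finsupp.equivFunOnFinite.symm (av c j) : Fin 5 →₀ ℕ) +
      Finsupp.equivFunOnFinite.symm (rv c)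
  rw [P2d4CChar2Fan.symm_sum_smul, ← Q6CNKit.symm_add, ← Q6CNKit.symm_nsmul, hunit_raw c]

/-- `hv`: the vertex monomials lie in the image of `I_A` modulo any `(Fs)` (use `hv k ![f]`). -/
theorem hv (k : Type) [Field k] : ∀ (Fs : Fin 1 → MvPolynomial (Fin 5) k) (c : Fin 41),
    Ideal.Quotient.mk (Ideal.span (Set.range Fs)) (monomial (m c) (1 : k)) ∈
      Ideal.span ((fun e : Fin 5 →₀ ℕ => Ideal.Quotient.mk (Ideal.span (Set.range Fs)) (monomial e (1 : k))) '' (A : Set (Fin 5 →₀ ℕ))) :=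
  fun _ c => Ideal.subset_span ⟨m c, Finset.mem_coe.mpr (hm c), rfl⟩

/-- No variable divides a strict transform (`¬ Yᵢ ∣ g_c`). -/
theorem hX (k : Type) [Field k] [CharP k 2] : ∀ (c : Fin 41) (i : Fin 5), ¬ (X i ∣ KLocCellKit.evalL k (G c)) := by
  intro c
  unfold KLocCellKit.evalL
  exact NotDvdOfSupport.forall_not_X_dvd_evalL 2 (G c) (hX_raw c)

/-- The strict transforms are non-zero. -/
theorem hg0 (k : Type) [Field k] [CharP k 2] : ∀ c : Fin 41, KLocCellKit.evalL k (G c) ≠ 0 :=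
  fun c h => hX k c 0 (by rw [h]; exact dvd_zero _)

end Summit.ResolutionOfSingularities.ResolutionOfSingularities.Theorems.FInjectiveMacaulayfication.Lx6q7PointKChar2Fan

end
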